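import Summits.BirchSwinnertonDyer.Rank1Residual.X12.CMRamifiedRecordSchema
import HarnessLib

/-!
# Leaf `CornerF ∧ p ramified in K` (K12r): certificate-record schema, PART C — the O11 FRAME records of
# the slice `p = 3` (cell `bsd-print-cfram`, typer seat `ty3`; addendum to `X12/CMRamifiedRecordSchema.lean`
# and `…SchemaB.lean`; the data the typed O11@3 triple of `X12/O11/RamifiedStrictDescentAtThree.lean`
# quantifies over)

HONEST FRAMING (cell `bsd-print-cfram`, run/shared/lean/pub/bsd-print-cfram/, verbatim in every file
of the cell): PARTITION currency only — the leaf counts when its class theorem is in the kernel BY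
NAME, flag-free; Literature named facts are statement-only with cite tags, never sorried theorems;
every imported theorem carries its printed hypotheses verbatim; numbers, not adjectives. THIS FILE IS
DATA INFRASTRUCTURE (computable records, a decidable recheck); nothing about any elliptic curve is
asserted, no named fact is introduced, nothing is booked, no mark moves (the leaf K12r stays OPEN; its
`p = 3` slice `Summit.BirchSwinnertonDyer.WAllCornerFRamifiedAtThree` stays OPEN).

## What a `FrameThreeRow` records (one per K12r@3 class: the 98 of the window `N < 2·10⁴` + the two
## beyond-window EXCESS-2 classes `309123c/d`)

`X12/O11/RamifiedStrictDescentAtThree.lean` (ty2, p539796) re-types O11 at the ramified prime `3`: a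
frame `IsFrameThree W K 𝔭 W' C` (`K = ℚ(√−3)`, `𝔭 = (√−3)`, `W' = C • W^{(−3)}`), the three inputs
(R-tors)₃ / (R-ctrl)₃ / (R-EU)₃ and the PROVED consumer `bsdp_three_of_halves`, whose per-class
BINDERS are: generators `P ∈ W(ℚ)`, `P' ∈ W'(ℚ)` modulo torsion with their `3`-DIVISIBILITY LEVELS
`n, n'` in `W(ℚ₃)`, `W'(ℚ₃)` (`hdiv`/`hndiv`: `3ⁿ ∣ P`, `3ⁿ⁺¹ ∤ P`), NO `3`-torsion in `W(ℚ₃)` and in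
`W'(ℚ₃)` (`htors`, `htors'` — at `3` a genuine restriction), and the degree-one away input `hv` (at
every place `v ∤ 3` of `K` with `e = f = 1`, i.e. over a prime `ℓ ≡ 1 (mod 3)`: `W_K` good at `v` or
`W(K_v)[3] = 0`); (R-EU)₃ then reads `n₀ + log₃ #X[T] = n + n' + ord₃ #Ш_an(W) + ord₃ #Ш_an(W')`.
For a K12r@3 class every `j = 0` member is `≅ E_k : y² = x³ + k` (`k` sixth-power-free, PART A's
`twistD` / PART B's `J0Member.k`), and `E_k^{(−3)} ≅ E_{−27k}` is the `3`-ISOGENOUS member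
(`φ : E_k → E_{−27k}`, kernel `⟨(0, ±√k)⟩`). A record holds, for `W` = Cremona curve 1 `= E_k` and
`W' = E_{k'}`, `k'` = sixth-power-free part of `−27k` (class member `twinNum`; `k'·w₁⁶ = −27k·w₂⁶`):
* the models, `k`-identities (`c₄ = 0`, `c₆·u₁⁶ = −864·k·u₂⁶`), `#E(ℚ)_tors`, the Kodaira code and
  `c₃` at `3`, the Tamagawa numbers `(ℓ, c_ℓ)` at every bad prime (ENGINES A ‖ B), the generator
  `(gX/gd², gY/gd³)` (Cremona `allgens`);
* `t3loc` = the number of non-zero `3`-torsion points of `E(ℚ₃)` found by the engines (roots of the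
  `3`-division polynomial in `ℚ₃` with a `ℚ₃`-rational `y`), and the bit `torsFree3 := (t3loc = 0)`,
  RECHECKED against the closed form on `k` (§1): `ψ₃ = 3x(x³ + 4k)` for `y² = x³ + k`, so the non-zero
  `3`-torsion points are `(0, ±√k)` and `(x, ±√(−3k))` with `x³ = −4k`, and
  `E_k(ℚ₃)[3] ≠ 0 ⟺ k ∈ ℚ₃ײ ∨ (−4k ∈ ℚ₃׳ ∧ −3k ∈ ℚ₃ײ)` (`u·3ᵛ ∈ ℚ₃ײ ⟺ 2 ∣ v ∧ u ≡ 1 (3)`;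
  `u·3ᵛ ∈ ℚ₃׳ ⟺ 3 ∣ v ∧ u ≡ ±1 (9)`);
* the LEVEL data: `m = 3·c₃` (the order of `E(ℚ₃)/E₁(ℚ₃)` at an additive prime is `c₃·#Ẽ_ns(𝔽₃) =
  3c₃`, so `[m]G ∈ E₁(ℚ₃)`), ENGINE A's `v₃(x([m]G))`, ENGINE B's `v₃(t([m]G))` (`t = −x/y`),
  `vlog = v₃(log_ω G) := v₃(log_{Ê}(t([m]G))) − v₃(m)` (the formal logarithm is an isometry on
  `E₁(ℚ₃) = Ê(3ℤ₃)` since `1 > 1/(3−1)`; two engines: PARI `ellpadiclog` ‖ Sage's formal-group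
  series), the level `n`, and ENGINE B's level-by-division `nDiv = max{j ≤ 3 : G ∈ 3ʲE(ℚ₃)}` (exact
  multiplication-by-`3ʲ` `x`-map over `ℚ`, roots in `ℚ₃`, `y`-solvability). INDEX ANALYSIS behind
  `n = vlog + v₃(c₃)`: when `E(ℚ₃)[3] = 0`, `E(ℚ₃) ≅ ℤ₃ × T` with `#T` prime to `3`, `log` kills
  exactly `T`, `log(E₁) = 3ℤ₃`, `[E(ℚ₃) : E₁] = 3c₃`, hence `log(E(ℚ₃)) = 3^{−v₃(c₃)}ℤ₃` and the
  `3`-divisibility level of `G` is `v₃(log_ω G) + v₃(c₃)`; the kernel checks `n = vlog + v₃(c₃)` and,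
  on `torsFree3` rows, `n = nDiv` (two METHODS agree); on the other rows `n` is displayed but NOT a
  binder value (the level is then not torsion-independent);
* the `3`-DESCENT dims of p4's certificate (`X12/JZeroThreeRecords*.lean`, HOME/p4/CERTIFICATES.md):
  `s_φ = dim Sel^φ(E_k)`, `s_φ̂ = dim Sel^φ̂(E_{−27k})`, `m_desc = rank + [k ∈ ℚײ] + [−3k ∈ ℚײ]`,
  `EXCESS = s_φ + s_φ̂ − m_desc` (three engines: x1b `x12sel3.gp`, sha-2 `iso3kum.gp`, the cell
  referee's `REF-sel3.gp` S1/S3), for both members — the C10 column of the cell's hypothesis dossier;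
* `#Ш_an(W)`, `#Ш_an(W')` (PART A, two engines there) and `pred := n + n' + ord₃ #Ш_an + ord₃ #Ш'_an`
  = the right-hand side of (R-EU)₃ — the `p = 3` twin of the PREDICTION table
  `X12/CMRamifiedLevelsFiveLe.lean`;
* the bits `torsFree3`, `torsFree3'`, `away` (`3 ∤ c_ℓ(W)` at every bad `ℓ ≡ 1 (mod 3)`: for additive
  `ℓ ≠ 3`, `E(ℚ_ℓ)[3] ≅ Φ_ℓ(𝔽_ℓ)[3]` since `E₀(ℚ_ℓ)` is pro-`ℓ` by `𝔽_ℓ⁺`; at a split `ℓ`, `K_v = ℚ_ℓ`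
  and `W'_{ℚ_ℓ} ≅ W_{ℚ_ℓ}` as `−3 ∈ ℚ_ℓײ`, so the kernel also checks `c_ℓ(W) = c_ℓ(W')` there) and
  `subLeaf := torsFree3 ∧ torsFree3' ∧ away` = «this class carries the binders `htors`, `htors'`,
  `hv` of the typed O11@3 triple» — the classes with `subLeaf = false` are NOT addressed by that
  triple as typed (a `Σ`-imprimitive variant or another road is needed there).
ENGINES: A = PARI/GP (`ellglobalred`, `elllocalred`, `elltors`, `elldivpol` + `polrootspadic`,
`ellmul`, `ellpadiclog`); B = SageMath (`conductor`, `local_data`/Tate, `torsion_order`,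
`division_polynomial(3).roots(ℚ₃)`, `multiplication_by_m(3ʲ)` + roots in `ℚ₃`, `formal_group().log`
series); kit jobs named in each display file. NOT rechecked by the kernel (engines' work): conductor,
minimality, Kodaira/`c_ℓ` values, the root counts `t3loc`, the valuations `vxA/vtB`, `nDiv`, the
descent dims, `#Ш_an`. RECHECKED (`FrameThreeRow.consistent`, by `decide` in the display files): all
identities among the recorded integers listed in §3, the closed-form `3`-torsion criterion against
`t3loc`, the away bit against the recorded `c_ℓ`, `m = 3c₃`, `vxA = −2·vtB`, `vlog = vtB − v₃(m)`,
`n = vlog + v₃(c₃)`, `torsFree3 → n = nDiv`, `m_desc`/`EXCESS` arithmetic with the `ℚ`-square tests,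
`pred`, `subLeaf`.

References: `X12/O11/RamifiedStrictDescentAtThree.lean` (the binders); `X12/O11/RamifiedStrictDescent.lean`
((★_an)); `X12/CMRamifiedRecordSchema{,B}.lean` (PARTS A/B, helpers reused; nothing re-declared);
`X12/JZeroThreeDescent.lean`, `X12/JZeroThreeRecordsA.lean` (the `3`-descent certificate, EXCESS);
[SilvermanAEC2009] IV.1–IV.6 (formal group, `log` an isometry on `Ê(p^r ℤ_p)` for `r > 1/(p−1)`),
VII.2–VII.6 (the filtration `E₁ ⊂ E₀ ⊂ E(ℚ_p)`, `E₀/E₁ ≅ Ẽ_ns(𝔽_p)`, `c_p`), Ex. 10.19 / X.§6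
(`3`-torsion of `y² = x³ + k`); [Cremona1997] `ecdata allgens/allbsd`.
-/

set_option autoImplicit false

namespace Summit.BirchSwinnertonDyer.Rank1Residual.X12.CMRamifiedRecords

open Summit.BirchSwinnertonDyer.BirchSwinnertonDyer.Rank1Residual.HeegnerIndexRecords
open Summit.BirchSwinnertonDyer.Rank1Residual.X10.JetchevTamagawaRecords (c6 tamAt)

/-! ### §1 Helpers: squares and cubes in `ℚ₃` and in `ℚ`, on integers (computable) -/

/-- The `3`-adic unit part `k / 3^{v₃(k)}` of a non-zero integer (junk `0 ↦ 0`). [folklore] -/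
def unit3 (k : ℤ) : ℤ := k / (3 : ℤ) ^ (vp 3 k)

/-- `k ∈ ℚ₃ײ` for a non-zero integer `k = u·3ᵛ` (`3 ∤ u`): `2 ∣ v` and `u ≡ 1 (mod 3)` (Hensel; the
squares of `ℤ₃ˣ` are the units `≡ 1 (mod 3)`). [cite: Serre1973, Ch. II §3.3 (squares in ℚ_p)] -/
def isSqQ3 (k : ℤ) : Bool := (k != 0) && (vp 3 k % 2 == 0) && (unit3 k % 3 == 1)

/-- `k ∈ ℚ₃׳` for a non-zero integer `k = u·3ᵛ` (`3 ∤ u`): `3 ∣ v` and `u ≡ ±1 (mod 9)` (the cubes of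
`ℤ₃ˣ` are the units `≡ ±1 (mod 9)`: `(1 + 3a)³ ≡ 1 (mod 9)` and Hensel from precision `9`). [folklore] -/
def isCubeQ3 (k : ℤ) : Bool :=
  (k != 0) && (vp 3 k % 3 == 0) && (unit3 k % 9 == 1 || unit3 k % 9 == 8)

/-- **Closed form of `E_k(ℚ₃)[3] ≠ 0` for `E_k : y² = x³ + k`**: the `3`-division polynomial is
`ψ₃ = 3x⁴ + 12kx = 3x(x³ + 4k)`, so a non-zero `3`-torsion point has `x = 0` (then `y² = k`) or
`x³ = −4k` (then `y² = −3k`); hence `E_k(ℚ₃)[3] ≠ 0 ⟺ k ∈ ℚ₃ײ ∨ (−4k ∈ ℚ₃׳ ∧ −3k ∈ ℚ₃ײ)`. (The two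
cases are exclusive — `2 ∣ v₃(k)` versus `v₃(k) ≡ 0 (mod 3) ∧ 2 ∤ v₃(k)` — and `ℚ₃` has one cube root
at most, so `#E_k(ℚ₃)[3] ∈ {1, 3}`.) [cite: SilvermanAEC2009, Exercise 3.7 and III.2 (division polynomial ψ₃ = 3x⁴ + b₂x³ + 3b₄x² + 3b₆x + b₈)] -/
def hasLocal3Tors (k : ℤ) : Bool := isSqQ3 k || (isCubeQ3 (-4 * k) && isSqQ3 (-3 * k))

/-- The predicted number of NON-ZERO `3`-torsion points of `E_k(ℚ₃)`: `2` in either case of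
`hasLocal3Tors`, else `0` (what the engines' `t3loc` must equal). [folklore] -/
def local3TorsCount (k : ℤ) : ℕ := if hasLocal3Tors k then 2 else 0

/-- Integer square root by fuel-bounded bisection (structural recursion, so that `decide` reduces it;
`Nat.sqrt` is well-founded and does not): the largest `r ∈ [lo, hi]` with `r² ≤ n`, given
`lo² ≤ n`. [folklore] -/
def sqrtAux : ℕ → ℕ → ℕ → ℕ → ℕ
  | 0, lo, _, _ => lo
  | fuel + 1, lo, hi, n =>
      if hi ≤ lo then lo
      else
        let mid := (lo + hi + 1) / 2
        if mid * mid ≤ n then sqrtAux fuel mid hi n else sqrtAux fuel lo (mid - 1) n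

/-- `⌊√n⌋` for `n < 2¹²⁸` (128 bisection steps). [folklore] -/
def natSqrtFuel (n : ℕ) : ℕ := sqrtAux 128 0 n n

/-- `z ∈ ℚײ` for an integer: `z > 0` and a perfect square (bisection square root). [folklore] -/
def isSqZ (z : ℤ) : Bool := decide (0 < z) && (natSqrtFuel z.toNat * natSqrtFuel z.toNat == z.toNat)

/-- The degree-one AWAY bit on a recorded Tamagawa list `(ℓ, c_ℓ)`: at every bad `ℓ ≠ 3` with
`ℓ ≡ 1 (mod 3)` (the primes SPLIT in `ℚ(√−3)`), `3 ∤ c_ℓ` — i.e. `E(ℚ_ℓ)[3] = 0` there, since at an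
additive `ℓ ≠ 3` the `3`-torsion of `E(ℚ_ℓ)` is that of the component group. [cite: SilvermanAEC2009, VII.2.1 and VII.6.1 (E₁ pro-ℓ, E₀/E₁ ≅ Ẽ_ns)] -/
def awayOK (tam : List (ℕ × ℕ)) : Bool :=
  tam.all fun lc => lc.1 == 3 || lc.1 % 3 != 1 || lc.2 % 3 != 0

/-- At the split primes `ℓ ≡ 1 (mod 3)` the two members `W ≅_{ℚ_ℓ} W'` have the same `c_ℓ`
(cross-check of the two recorded Tamagawa lists). [folklore] -/
def splitTamAgree (tam tam' : List (ℕ × ℕ)) : Bool :=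
  tam.all fun lc => lc.1 % 3 != 1 || tamAt tam' lc.1 == lc.2

/-! ### §2 The record type -/

/-- **One O11-FRAME record of a K12r@3 class** (module docstring): `W` = curve 1 `= E_k` and the
`3`-isogenous twin `W' = E_{k'} ≅ W^{(−3)}` (member `twinNum`), each with model, `k`-identity scalings,
`#tors`, Kodaira code / `c₃` at `3`, Tamagawa list, generator, level data (`m, vxA, vtB, vlog, n, nDiv`),
local `3`-torsion count `t3loc`, `3`-descent dims (`sPhi, sPhiHat, mDesc, exc`); then `#Ш_an`,
`#Ш'_an`, `pred`, the bits `torsFree3/torsFree3'/away/subLeaf`, engine counts and provenance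
(display strings). Primed fields are `W'`'s. [folklore] -/
structure FrameThreeRow where
  label : String
  cls : String
  N : ℕ
  Nfactors : List (ℕ × ℕ)
  -- W = curve 1 = E_k
  ainvs : List ℤ
  k : ℤ
  u1 : ℕ
  u2 : ℕ
  tors : ℕ
  kod3 : ℤ
  c3 : ℕ
  tam : List (ℕ × ℕ)
  gX : ℤ
  gY : ℤ
  gd : ℕ
  m : ℕ
  vxA : ℤ
  vtB : ℕ
  vlog : ℤ
  n : ℕ
  nDiv : ℕ
  t3loc : ℕ
  sPhi : ℕ
  sPhiHat : ℕ
  mDesc : ℕ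
  exc : ℕ
  -- W' = E_{k'} = W^{(-3)}, the 3-isogenous member
  twinNum : ℕ
  twinAinvs : List ℤ
  k' : ℤ
  tu1 : ℕ
  tu2 : ℕ
  w1 : ℕ
  w2 : ℕ
  tors' : ℕ
  kod3' : ℤ
  c3' : ℕ
  tam' : List (ℕ × ℕ)
  tgX : ℤ
  tgY : ℤ
  tgd : ℕ
  m' : ℕ
  vxA' : ℤ
  vtB' : ℕ
  vlog' : ℤ
  n' : ℕ
  nDiv' : ℕ
  t3loc' : ℕ
  sPhi' : ℕ
  sPhiHat' : ℕ
  mDesc' : ℕ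
  exc' : ℕ
  -- class data and bits
  shaAn : ℕ
  twinShaAn : ℕ
  pred : ℕ
  torsFree3 : Bool
  torsFree3' : Bool
  away : Bool
  subLeaf : Bool
  levelEngines : ℕ
  descEngines : ℕ
  engines : String

namespace FrameThreeRow

/-- Block 1 (shape): five a-invariants twice, `N` with its factorisation, `3² ∣ N` (additive at `3`),
both Tamagawa lists indexed by exactly the primes of `N`, `c₃`/`c₃'` = their entries at `3`,
`1 ≤ c₃, c₃' ≤ 4`. [folklore] -/
def shapeOK (r : FrameThreeRow) : Bool :=
  (r.ainvs.length == 5) && (r.twinAinvs.length == 5) && factorsOK r.N r.Nfactors &&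
  (r.Nfactors.any fun qe => qe.1 == 3 && decide (2 ≤ qe.2)) &&
  (r.tam.map Prod.fst == r.Nfactors.map Prod.fst) && (r.tam'.map Prod.fst == r.Nfactors.map Prod.fst) &&
  (tamAt r.tam 3 == r.c3) && (tamAt r.tam' 3 == r.c3') &&
  decide (1 ≤ r.c3) && decide (r.c3 ≤ 4) && decide (1 ≤ r.c3') && decide (r.c3' ≤ 4) &&
  decide (1 ≤ r.tors) && decide (1 ≤ r.tors')

/-- Block 2 (`j = 0` models and the twin): `c₄ = 0`, `Δ ≠ 0`, `c₆·u₁⁶ = −864·k·u₂⁶` for `W` and for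
`W'` (with `k'`), `k ≠ 0`, and `k'·w₁⁶ = −27·k·w₂⁶` (`W' ≅ E_{−27k} ≅ W^{(−3)}`). [folklore] -/
def modelOK (r : FrameThreeRow) : Bool :=
  (c4 r.ainvs == 0) && (discr r.ainvs != 0) && decide (1 ≤ r.u1) && decide (1 ≤ r.u2) && (r.k != 0) &&
  (c6 r.ainvs * (r.u1 : ℤ) ^ 6 == -864 * r.k * (r.u2 : ℤ) ^ 6) &&
  (c4 r.twinAinvs == 0) && (discr r.twinAinvs != 0) && decide (1 ≤ r.tu1) && decide (1 ≤ r.tu2) &&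
  (c6 r.twinAinvs * (r.tu1 : ℤ) ^ 6 == -864 * r.k' * (r.tu2 : ℤ) ^ 6) &&
  decide (1 ≤ r.w1) && decide (1 ≤ r.w2) && (r.k' * (r.w1 : ℤ) ^ 6 == -27 * r.k * (r.w2 : ℤ) ^ 6)

/-- Block 3 (generators): both recorded generators lie ON their curves, exactly. [folklore] -/
def gensOK (r : FrameThreeRow) : Bool :=
  decide (1 ≤ r.gd) && (weierstrassEvalZ r.ainvs r.gX r.gY r.gd == 0) &&
  decide (1 ≤ r.tgd) && (weierstrassEvalZ r.twinAinvs r.tgX r.tgY r.tgd == 0)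

/-- The level relations of ONE curve (module docstring): `m = 3c₃`, `[m]G ∈ E₁` (`vtB ≥ 1`),
`vxA = −2·vtB`, `vlog = vtB − v₃(m)`, `n = vlog + v₃(c₃)`, and `torsFree → n = nDiv`. [folklore] -/
def levelRel (c3 m : ℕ) (vxA : ℤ) (vtB : ℕ) (vlog : ℤ) (n nDiv : ℕ) (torsFree : Bool) : Bool :=
  (m == 3 * c3) && decide (1 ≤ vtB) && (vxA == -(2 * (vtB : ℤ))) &&
  (vlog == (vtB : ℤ) - (vp 3 m : ℤ)) && ((n : ℤ) == vlog + (vp 3 c3 : ℤ)) && (!torsFree || n == nDiv)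

/-- Block 4 (levels): `levelRel` for `W` and for `W'`, two level engines. [folklore] -/
def levelsOK (r : FrameThreeRow) : Bool :=
  levelRel r.c3 r.m r.vxA r.vtB r.vlog r.n r.nDiv r.torsFree3 &&
  levelRel r.c3' r.m' r.vxA' r.vtB' r.vlog' r.n' r.nDiv' r.torsFree3' && decide (2 ≤ r.levelEngines)

/-- Block 5 (local `3`-torsion): the bits are the closed form on `k`, `k'` (§1 `hasLocal3Tors`) AND
agree with the engines' root counts `t3loc`, `t3loc'`. [folklore] -/
def torsOK (r : FrameThreeRow) : Bool :=
  (r.torsFree3 == !hasLocal3Tors r.k) && (r.t3loc == local3TorsCount r.k) &&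
  (r.torsFree3' == !hasLocal3Tors r.k') && (r.t3loc' == local3TorsCount r.k')

/-- Block 6 (away + sub-leaf): `away = awayOK tam`, the two Tamagawa lists agree at the split primes,
and `subLeaf = torsFree3 ∧ torsFree3' ∧ away`. [folklore] -/
def awayBitsOK (r : FrameThreeRow) : Bool :=
  (r.away == awayOK r.tam) && splitTamAgree r.tam r.tam' &&
  (r.subLeaf == (r.torsFree3 && r.torsFree3' && r.away))

/-- Block 7 (`3`-descent dims): `m_desc = 1 + [k ∈ ℚײ] + [−3k ∈ ℚײ]` (rank `1`),
`s_φ + s_φ̂ = m_desc + EXCESS`, for both members; at least two descent engines. [folklore] -/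
def descentOK (r : FrameThreeRow) : Bool :=
  (r.mDesc == 1 + (if isSqZ r.k then 1 else 0) + (if isSqZ (-3 * r.k) then 1 else 0)) &&
  (r.sPhi + r.sPhiHat == r.mDesc + r.exc) &&
  (r.mDesc' == 1 + (if isSqZ r.k' then 1 else 0) + (if isSqZ (-3 * r.k') then 1 else 0)) &&
  (r.sPhi' + r.sPhiHat' == r.mDesc' + r.exc') && decide (2 ≤ r.descEngines)

/-- Block 8 ((R-EU)₃'s right-hand side): `#Ш_an, #Ш'_an ≥ 1` and
`pred = n + n' + ord₃ #Ш_an + ord₃ #Ш'_an`. [folklore] -/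
def predOK (r : FrameThreeRow) : Bool :=
  decide (1 ≤ r.shaAn) && decide (1 ≤ r.twinShaAn) &&
  (r.pred == r.n + r.n' + vp 3 r.shaAn + vp 3 r.twinShaAn)

/-- **The in-kernel recheck of a `FrameThreeRow`**: the eight blocks. [folklore] -/
def consistent (r : FrameThreeRow) : Bool :=
  r.shapeOK && r.modelOK && r.gensOK && r.levelsOK && r.torsOK && r.awayBitsOK && r.descentOK && r.predOK

/-- `consistent` unpacked into its eight blocks. [folklore] -/
theorem consistent_iff (r : FrameThreeRow) :
    r.consistent = true ↔
      r.shapeOK = true ∧ r.modelOK = true ∧ r.gensOK = true ∧ r.levelsOK = true ∧ r.torsOK = true ∧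
        r.awayBitsOK = true ∧ r.descentOK = true ∧ r.predOK = true := by
  simp only [consistent, Bool.and_eq_true]
  tauto

/-- A consistent record's sub-leaf bit is exactly «no local `3`-torsion on `W` and on `W'` (closed
form on `k`, `k'`) and the degree-one away condition on the recorded Tamagawa list». [folklore] -/
theorem subLeaf_eq_of_consistent {r : FrameThreeRow} (h : r.consistent = true) :
    r.subLeaf = (!hasLocal3Tors r.k && !hasLocal3Tors r.k' && awayOK r.tam) := by
  obtain ⟨-, -, -, -, ht, ha, -⟩ := (consistent_iff r).1 h
  simp only [torsOK, Bool.and_eq_true, beq_iff_eq] at ht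
  simp only [awayBitsOK, Bool.and_eq_true, beq_iff_eq] at ha
  obtain ⟨⟨⟨h1, -⟩, h2⟩, -⟩ := ht
  obtain ⟨⟨h3, -⟩, h4⟩ := ha
  rw [h4, h1, h2, h3]

/-- A consistent record reads `pred = n + n' + ord₃ #Ш_an + ord₃ #Ш'_an`. [folklore] -/
theorem pred_eq_of_consistent {r : FrameThreeRow} (h : r.consistent = true) :
    r.pred = r.n + r.n' + vp 3 r.shaAn + vp 3 r.twinShaAn := by
  obtain ⟨-, -, -, -, -, -, -, hp⟩ := (consistent_iff r).1 h
  simp only [predOK, Bool.and_eq_true, beq_iff_eq, decide_eq_true_eq] at hp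
  exact hp.2

/-- On a consistent record with `torsFree3`, the log-based level and the division-based level of the
generator of `W` agree (`n = nDiv`); likewise for `W'`. [folklore] -/
theorem n_eq_nDiv_of_consistent {r : FrameThreeRow} (h : r.consistent = true) :
    (r.torsFree3 = true → r.n = r.nDiv) ∧ (r.torsFree3' = true → r.n' = r.nDiv') := by
  obtain ⟨-, -, -, hl, -⟩ := (consistent_iff r).1 h
  simp only [levelsOK, levelRel, Bool.and_eq_true, beq_iff_eq, Bool.or_eq_true, Bool.not_eq_true',
    decide_eq_true_eq] at hl
  obtain ⟨⟨⟨-, h1⟩, ⟨-, h2⟩⟩, -⟩ := hl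
  refine ⟨fun ht => ?_, fun ht => ?_⟩
  · rcases h1 with h1 | h1
    · rw [ht] at h1; exact absurd h1 (by decide)
    · exact h1
  · rcases h2 with h2 | h2
    · rw [ht] at h2; exact absurd h2 (by decide)
    · exact h2

end FrameThreeRow

/-- Unpacking a display theorem `rs.all FrameThreeRow.consistent = true` per member. [folklore] -/
theorem FrameThreeRow.consistent_of_all {rs : List FrameThreeRow}
    (h : rs.all FrameThreeRow.consistent = true) {r : FrameThreeRow} (hr : r ∈ rs) :
    r.consistent = true :=
  List.all_eq_true.1 h r hr

end Summit.BirchSwinnertonDyer.Rank1Residual.X12.CMRamifiedRecords
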